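import Summits.Ventures.WeilGRH.TwistedGramCellSignsOdd
import Literature.Analysis.ValidatedNumerics.IntervalLogArctan
import Literature.Analysis.ValidatedNumerics.PeriodicTrapezoidCert
import HarnessLib

/-!
# GRH arm (rh-explicit, venture WeilGRH): twisted format C — ODD far-diagonal sign facts WITH the arctan column penalty

Cell `rh-explicit`, WEIL TRACK — GRH ARM (engine seat weil-grh-2 gen9).  Sequel of `TwistedGramCellSignsOdd.lean` (gen7).  The
data doors allow the column weight `w_l ≤ d̂⁻(l)` with the EXACT penalty `(π/2 − arctan √(B/(l+1)))/2`; gen7's kernel box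
`dhatOBox` replaced it by its bound `π/4` (up to `π/8 ≈ 0.39` too pessimistic on the first columns `l ≈ B`), which is why
the kernel's odd blocks run one size larger than the float twin's (gen8/gen9: `(5/·)@59/100` 8×16 → 8×32, `(−3/·)@59/100`
8×32 → 10×32).  Here the penalty is enclosed in the kernel (`PeriodicTrapezoid.sqrtI` + weil-2's `MI.arctan`):

* `penBox` / `mem_penBox` — a box of `(π/2 − arctan √(B/(l+1)))/2`;
* `dhatOBoxA` / `mem_dhatOBoxA` — the sharp odd far diagonal `d̂⁻(l)` as a box;
* `checkSignsOA` and ★ `signsO_of_checkSignsOA` — the SAME conclusion as `signsO_of_checkSignsO` (`h0o`, `hd0o`, `hwo` of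
  the doors), so every cell file can switch checkers without touching the door call.

Everything is PROVED; computable `def`s with docstrings; no named facts; RH/GRH-free; standard axioms.
References: H. Yoshida (1992) §7 [Yoshida1992HermitianForms]; R. E. Moore (1966) Ch. 3 [Moore1966].
-/

set_option autoImplicit false

open Real Complex Finset
open scoped BigOperators ArithmeticFunction.vonMangoldt

namespace Summit.Ventures.WeilGRH

open Literature.NumberTheory.LFunctions Literature.NumberTheory.LFunctions.Yoshida1992
open Literature.NumberTheory.LFunctions.Yoshida1992.Encl
open Literature.Analysis.SpecialFunctions Literature.Analysis.ValidatedNumerics.NumericsMP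
open Literature.Analysis.ValidatedNumerics (PeriodicTrapezoid.sqrtI PeriodicTrapezoid.mem_sqrtI)

namespace TwistedEncl

variable {S : ℕ} {a : ℝ} {q : ℕ}

/-! ## The column penalty `(π/2 − arctan √(B/(l+1)))/2` as a box -/

/-- Box of `(π/2 − arctan √(B/(l+1)))/2` (`Karc` arctan series terms). [cite: Moore1966, Ch. 3 (interval arithmetic: inclusion property)] -/
def penBox (S Karc : ℕ) (P : MI) (B l : ℕ) : Option MI :=
  match PeriodicTrapezoid.sqrtI S (MI.ofFrac S B (l + 1)) with
  | some X => (MI.arctan S Karc P X).map fun T ↦ ((P.divNat 2).sub T).divNat 2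
  | none => none

/-- `penBox` encloses `(π/2 − arctan(√B/√(l+1)))/2`. [cite: Moore1966, Ch. 3 (interval arithmetic: inclusion property)] -/
theorem mem_penBox (hS : 0 < S) {Karc : ℕ} {P : MI} (hP : MI.mem S Real.pi P) {B l : ℕ} {Y : MI}
    (h : penBox S Karc P B l = some Y) :
    MI.mem S ((π / 2 - Real.arctan (Real.sqrt B / Real.sqrt ((l : ℝ) + 1))) / 2) Y := by
  unfold penBox at h
  split at h
  · rename_i X hX
    cases hT : MI.arctan S Karc P X with
    | none => simp [hT] at h
    | some T =>
      simp only [hT, Option.map_some, Option.some.injEq] at h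
      subst h
      have hx : MI.mem S (((B : ℤ) : ℝ) / ((l + 1 : ℕ) : ℝ)) (MI.ofFrac S B (l + 1)) := MI.mem_ofFrac S B (by omega)
      have hsq := PeriodicTrapezoid.mem_sqrtI hS hX hx
      have hat := MI.mem_arctan hS hP hT hsq
      have e : Real.sqrt (((B : ℤ) : ℝ) / ((l + 1 : ℕ) : ℝ)) = Real.sqrt B / Real.sqrt ((l : ℝ) + 1) := by
        push_cast
        exact Real.sqrt_div' _ (by positivity)
      rw [e] at hat
      have hpi2 : MI.mem S (π / (2 : ℕ)) (P.divNat 2) := MI.mem_divNat hP (by norm_num)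
      have h2 := MI.mem_divNat (MI.mem_sub hpi2 hat) (n := 2) (by norm_num)
      refine mem_of_eq h2 ?_
      push_cast
      ring
  · simp at h

/-! ## The sharp odd far diagonal -/

/-- Box of the SHARP odd far diagonal `d̂⁻(l) = d̂′⁻(l) + π/4 − (π/2 − arctan √(B/(l+1)))/2` (`d̂′⁻` = gen7's crude box).
[cite: Yoshida1992HermitianForms, §7 pp. 305–312] -/
def dhatOBoxA (S Karc : ℕ) (C : Consts) (LQ : MI) (tab : List IdxRec) (d : OddCellData) (l : ℕ) : Option MI :=
  (penBox S Karc C.P d.B l).map fun Y ↦ ((dhatOBox S C LQ tab d l).add (C.P.divNat 4)).sub Y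

/-- Soundness of `dhatOBoxA` (`l + 1 < N`). [cite: Moore1966, Ch. 3 (interval arithmetic: inclusion property)] -/
theorem mem_dhatOBoxA (hS : 0 < S) {ks : List PrimeLen} {C : Consts} (hC : ConstsValid S a ks C) {LQ : MI} {Lq : ℝ}
    (hLQ : MI.mem S Lq LQ) {N : ℕ} {tab : List IdxRec} (hT : TabValid S a ks N tab) {d : OddCellData} {Cc Aop : ℝ}
    (hCC : MI.mem S Cc d.CC) (hAOP : MI.mem S Aop d.AOP) (hr8D : 0 < d.r8D) {Karc l : ℕ} (hl : l + 1 < N) {Z : MI}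
    (h : dhatOBoxA S Karc C LQ tab d l = some Z) :
    MI.mem S (dhatOLow a Lq Cc Aop ((d.r8N : ℝ) / d.r8D) l + π / 4
      - (π / 2 - Real.arctan (Real.sqrt d.B / Real.sqrt ((l : ℝ) + 1))) / 2) Z := by
  unfold dhatOBoxA at h
  cases hY : penBox S Karc C.P d.B l with
  | none => simp [hY] at h
  | some Y =>
    simp only [hY, Option.map_some, Option.some.injEq] at h
    subst h
    have h1 := mem_dhatOBox hS hC hLQ hT hCC hAOP hr8D hl (d := d)
    have h2 : MI.mem S (π / (4 : ℕ)) (C.P.divNat 4) := MI.mem_divNat hC.pi (by norm_num)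
    have h3 := mem_penBox hS hC.pi hY
    refine mem_of_eq (MI.mem_sub (MI.mem_add h1 h2) h3) ?_
    push_cast
    ring

/-- The odd sign checks with the sharp column weights: as `checkSignsO` for `r₈`, `d̂′⁻(B) > 0`, `d₀ ≤ d̂′⁻(B₃)`, but
`w_{B+c} ≤ d̂⁻(B+c)` against `dhatOBoxA`. [cite: Moore1966, Ch. 3 (interval arithmetic: inclusion property)] -/
def checkSignsOA (S Karc : ℕ) (C : Consts) (LQ : MI) (tab : List IdxRec) (d : OddCellData) : Bool :=
  decide (1 ≤ d.B) && decide (2 * d.B ≤ d.B3) && decide (0 < d.r8D) && decide (0 < d.d0N) &&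
    decide (8 * d.r8D ^ 2 ≤ d.B * d.r8N ^ 2) &&
    decide (0 < (dhatOBox S C LQ tab d d.B).lo) &&
    decide ((d.d0N : ℤ) * S ≤ (dhatOBox S C LQ tab d d.B3).lo * 2 ^ d.wbits) &&
    (List.range (d.B3 - d.B)).all fun c ↦ decide (0 < d.wN.getD c 0) &&
      match dhatOBoxA S Karc C LQ tab d (d.B + c) with
      | some Z => decide ((d.wN.getD c 0 : ℤ) * S ≤ Z.lo * 2 ^ d.wbits)
      | none => false

/-- ★ **The door's odd-sector sign facts from checked boxes, sharp column weights** — literally the conclusion of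
`signsO_of_checkSignsO` (`h0o`, `hd0o`, `hwo` of the twisted format-C data doors with `d0o = d0N·2^{−wbits}`,
`wo l = wN_{l−B}·2^{−wbits}`), from `checkSignsOA`. [cite: Yoshida1992HermitianForms, §7 pp. 305–312] -/
theorem signsO_of_checkSignsOA (hS : 0 < S) (ha0 : 0 < a) {ks : List PrimeLen} {C : Consts}
    (hC : ConstsValid S a ks C) {LQ : MI} (hLQ : MI.mem S (Real.log q) LQ) {N : ℕ} {tab : List IdxRec}
    (hT : TabValid S a ks N tab) {d : OddCellData} (hN : d.B3 + 1 < N)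
    (hCC : MI.mem S (a * (1 + weilArchDensity (2 * a))) d.CC)
    (hAOP : MI.mem S (∑ k ∈ weilPrimeIndex a, (Λ k : ℝ) / Real.sqrt k * (2 * Real.cos (π / (⌊2 * a / Real.log k⌋₊ + 2)))) d.AOP)
    {Karc : ℕ} (h : checkSignsOA S Karc C LQ tab d = true) :
    (0 < ((reDigammaQuarter (freq a ((d.B : ℤ) + 1)) - Real.log π + Real.log q) / 2 - 1 / (8 * ((d.B : ℝ) + 1)) - a * (1 + weilArchDensity (2 * a)) / (π ^ 2 * ((d.B : ℝ) + 1) ^ 2)) - π / 4 - a * (1 + weilArchDensity (2 * a)) / π ^ 2 * Real.sqrt (8 / d.B) - (∑ k ∈ weilPrimeIndex a, (Λ k : ℝ) / Real.sqrt k * (2 * Real.cos (π / (⌊2 * a / Real.log k⌋₊ + 2)))) / 2) ∧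
    (0 < (d.d0N : ℝ) / 2 ^ d.wbits ∧ (d.d0N : ℝ) / 2 ^ d.wbits ≤ ((reDigammaQuarter (freq a ((d.B3 : ℤ) + 1)) - Real.log π + Real.log q) / 2 - 1 / (8 * ((d.B3 : ℝ) + 1)) - a * (1 + weilArchDensity (2 * a)) / (π ^ 2 * ((d.B3 : ℝ) + 1) ^ 2)) - π / 4 - a * (1 + weilArchDensity (2 * a)) / π ^ 2 * Real.sqrt (8 / d.B) - (∑ k ∈ weilPrimeIndex a, (Λ k : ℝ) / Real.sqrt k * (2 * Real.cos (π / (⌊2 * a / Real.log k⌋₊ + 2)))) / 2) ∧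
    (∀ l, d.B ≤ l → l < d.B3 → 0 < (d.wN.getD (l - d.B) 0 : ℝ) / 2 ^ d.wbits ∧ (d.wN.getD (l - d.B) 0 : ℝ) / 2 ^ d.wbits ≤ ((reDigammaQuarter (freq a ((l : ℤ) + 1)) - Real.log π + Real.log q) / 2 - 1 / (8 * ((l : ℝ) + 1)) - a * (1 + weilArchDensity (2 * a)) / (π ^ 2 * ((l : ℝ) + 1) ^ 2) - (π / 2 - Real.arctan (Real.sqrt d.B / Real.sqrt ((l : ℝ) + 1))) / 2 - a * (1 + weilArchDensity (2 * a)) / π ^ 2 * Real.sqrt (8 / d.B) - (∑ k ∈ weilPrimeIndex a, (Λ k : ℝ) / Real.sqrt k * (2 * Real.cos (π / (⌊2 * a / Real.log k⌋₊ + 2)))) / 2)) := by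
  unfold checkSignsOA at h
  simp only [Bool.and_eq_true, decide_eq_true_eq, List.all_eq_true, List.mem_range] at h
  obtain ⟨⟨⟨⟨⟨⟨⟨hB1, hBB3⟩, hr8D⟩, hd0N⟩, hr8⟩, h0⟩, hd0⟩, hw⟩ := h
  -- the crude checker's conclusions for `h0o`, `hd0o` (same tests): re-assemble a `checkSignsO`-free argument
  set Cc := a * (1 + weilArchDensity (2 * a)) with hCc
  set Aop := ∑ k ∈ weilPrimeIndex a, (Λ k : ℝ) / Real.sqrt k * (2 * Real.cos (π / (⌊2 * a / Real.log k⌋₊ + 2))) with hAop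
  have hCc0 : 0 ≤ Cc := by
    have hE : 0 < weilArchDensity (2 * a) := weilArchDensity_pos (by positivity)
    positivity
  have hπ2 : 0 < π ^ 2 := by positivity
  have hr8' : Real.sqrt (8 / (d.B : ℝ)) ≤ (d.r8N : ℝ) / d.r8D := by
    have hB0 : (0 : ℝ) < d.B := by exact_mod_cast (show 0 < d.B by omega)
    have hrD : (0 : ℝ) < d.r8D := by exact_mod_cast hr8D
    have hq : (8 : ℝ) / (d.B : ℝ) ≤ ((d.r8N : ℝ) / d.r8D) ^ 2 := by
      have h' : (8 : ℝ) * (d.r8D : ℝ) ^ 2 ≤ (d.B : ℝ) * (d.r8N : ℝ) ^ 2 := by exact_mod_cast hr8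
      rw [div_pow, div_le_div_iff₀ hB0 (by positivity)]
      linarith
    calc Real.sqrt (8 / (d.B : ℝ)) ≤ Real.sqrt (((d.r8N : ℝ) / d.r8D) ^ 2) := Real.sqrt_le_sqrt hq
      _ = (d.r8N : ℝ) / d.r8D := Real.sqrt_sq (by positivity)
  have hSr : (0 : ℝ) < S := by exact_mod_cast hS
  have step : ∀ l, l + 1 < N →
      ((dhatOBox S C LQ tab d l).lo : ℝ) ≤ S * ((reDigammaQuarter (freq a ((l : ℤ) + 1)) - Real.log π + Real.log q) / 2 -
        1 / (8 * ((l : ℝ) + 1)) - Cc / (π ^ 2 * ((l : ℝ) + 1) ^ 2) - π / 4 - Cc / π ^ 2 * Real.sqrt (8 / d.B) - Aop / 2) := by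
    intro l hl
    have hmem := (mem_dhatOBox hS hC hLQ hT hCC hAOP hr8D hl).1
    unfold dhatOLow at hmem
    have h1 : Cc / π ^ 2 * Real.sqrt (8 / (d.B : ℝ)) ≤ Cc / π ^ 2 * ((d.r8N : ℝ) / d.r8D) :=
      mul_le_mul_of_nonneg_left hr8' (div_nonneg hCc0 hπ2.le)
    have h2 : Cc / π ^ 2 / (((l : ℝ) + 1) * ((l : ℝ) + 1)) = Cc / (π ^ 2 * ((l : ℝ) + 1) ^ 2) := by rw [div_div]; ring
    rw [h2] at hmem
    nlinarith
  have stepA : ∀ l, l + 1 < N → ∀ Z : MI, dhatOBoxA S Karc C LQ tab d l = some Z →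
      ((Z.lo : ℝ)) ≤ S * ((reDigammaQuarter (freq a ((l : ℤ) + 1)) - Real.log π + Real.log q) / 2 -
        1 / (8 * ((l : ℝ) + 1)) - Cc / (π ^ 2 * ((l : ℝ) + 1) ^ 2)
        - (π / 2 - Real.arctan (Real.sqrt d.B / Real.sqrt ((l : ℝ) + 1))) / 2 - Cc / π ^ 2 * Real.sqrt (8 / d.B) - Aop / 2) := by
    intro l hl Z hZ
    have hmem := (mem_dhatOBoxA hS hC hLQ hT hCC hAOP hr8D hl hZ).1
    unfold dhatOLow at hmem
    have h1 : Cc / π ^ 2 * Real.sqrt (8 / (d.B : ℝ)) ≤ Cc / π ^ 2 * ((d.r8N : ℝ) / d.r8D) :=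
      mul_le_mul_of_nonneg_left hr8' (div_nonneg hCc0 hπ2.le)
    have h2 : Cc / π ^ 2 / (((l : ℝ) + 1) * ((l : ℝ) + 1)) = Cc / (π ^ 2 * ((l : ℝ) + 1) ^ 2) := by rw [div_div]; ring
    rw [h2] at hmem
    nlinarith
  refine ⟨?_, ⟨by positivity, ?_⟩, fun l hBl hlB3 ↦ ⟨?_, ?_⟩⟩
  · have h1 := step d.B (by omega)
    have h0' : (0 : ℝ) < (dhatOBox S C LQ tab d d.B).lo := by exact_mod_cast h0
    have h3 := lt_of_lt_of_le h0' h1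
    rcases pos_and_pos_or_neg_and_neg_of_mul_pos h3 with ⟨_, h⟩ | ⟨h, _⟩
    · linarith
    · exact absurd h (not_lt.2 hSr.le)
  · have h1 := step d.B3 (by omega)
    have hd0' : ((d.d0N : ℤ) : ℝ) * S ≤ ((dhatOBox S C LQ tab d d.B3).lo : ℝ) * 2 ^ d.wbits := by exact_mod_cast hd0
    have h2 : (0 : ℝ) < 2 ^ d.wbits := by positivity
    rw [div_le_iff₀ h2]
    push_cast at hd0' h1 ⊢
    nlinarith
  · have := (hw (l - d.B) (by omega)).1
    positivity
  · have hw' := (hw (l - d.B) (by omega)).2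
    rw [show d.B + (l - d.B) = l by omega] at hw'
    split at hw'
    · rename_i Z hZ
      simp only [decide_eq_true_eq] at hw'
      have h1 := stepA l (by omega) Z hZ
      have hw'' : ((d.wN.getD (l - d.B) 0 : ℤ) : ℝ) * S ≤ ((Z.lo : ℤ) : ℝ) * 2 ^ d.wbits := by exact_mod_cast hw'
      have h2 : (0 : ℝ) < 2 ^ d.wbits := by positivity
      rw [div_le_iff₀ h2]
      push_cast at hw'' h1 ⊢
      nlinarith
    · simp at hw'

end TwistedEncl

end Summit.Ventures.WeilGRH
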